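import Mathlib.NumberTheory.NumberField.InfinitePlace.Ramification
import Literature.NumberTheory.GaloisRepresentations.AbsGaloisInvolutions

/-!
# The real place of an involution of an absolute Galois group is unique

Sequel to `AbsGaloisInvolutions.lean` (existence, Artin–Schreier): for a non-trivial involution
`σ` of an algebraically closed field `E` of characteristic zero, any two embeddings
`ι, ι' : E →+* ℂ` that intertwine `σ` with complex conjugation AGREE on the fixed field
`L = E^σ` (`AbsGaloisInvolution.ringHom_apply_eq_of_fixed`) and hence differ at most by complex
conjugation (`ringHom_eq_or_eq_conjugate`).  The proof does not rebuild the ordering of `L`: both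
embeddings are real on `L`, send squares of `L` to non-negative reals, and for every rational `q`
the element `a - q` of `L` is `±` a square (`fixed_isSquare_or`), so `ι a` and `ι' a` have the
same rational Dedekind cut — this is the uniqueness of the ordering of the real closed field `L`
(positive cone = squares) together with the uniqueness of order embeddings into `ℝ`.

Consequences for `Gal(K̄/K) = Field.absoluteGaloisGroup K`:
* `IsComplexConjugation.realEmbedding_unique` (any field `K`): a complex conjugation `c`
  determines its real embedding `φ : K →+* ℝ`; `IsComplexConjugationAt.place_unique`: it
  determines its real place;
* `infinitePlace_mk_eq_of_isConj` (`char K = 0`): over `K̄`, the infinite place of `K̄` at which a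
  given `c ≠ 1`, `c² = 1` is the conjugation is unique;
* `existsUnique_infinitePlace_mem_stabilizer_of_sq_eq_one` (`K` algebraic over `ℚ`): every
  involution `τ ≠ 1` of `Gal(K̄/K)` stabilises EXACTLY ONE infinite place of `K̄` — the
  archimedean dictionary «complex conjugations ↔ real-under-`K` archimedean primes of `K̄`» needed
  for the archimedean half of the valuation pro-set functoriality (abc-iut GAP-LEDGER G-L4d2g4-1,
  archimedean clause; consumer: `NumberFieldValuationProSet*`).
Proof-only file: no definitions, instances or notation.

References: S. Lang, *Algebra* (bib `Lang2002`), XI §2 Thm. 2.2 (1st ed. XI §2 Thm. 1: a real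
closed field has a unique ordering, the positive elements being the squares); E. Artin,
O. Schreier, *Eine Kennzeichnung der reell abgeschlossenen Körper* (1927), Satz 4
(bib `ArtinSchreier1927Kennzeichnung`); Mathlib `NumberField.InfinitePlace.mem_stabilizer_mk_iff`.
-/

noncomputable section

namespace Literature.NumberTheory.GaloisRepresentations

namespace AbsGaloisInvolution

variable {E : Type*} [Field E]

/-- If `ι : E →+* ℂ` intertwines the involution `σ` with complex conjugation, then `ι` is real on
the fixed field of `σ`. [folklore] -/
private theorem re_eq_of_fixed (σ : E ≃+* E) (ι : E →+* ℂ)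
    (hι : ∀ z, ι (σ z) = starRingEnd ℂ (ι z)) {b : E} (hb : σ b = b) :
    (((ι b).re : ℝ) : ℂ) = ι b := by
  have h := hι b
  rw [hb] at h
  exact Complex.conj_eq_iff_re.mp h.symm

/-- **Rigidity on the fixed field.** Two embeddings `ι, ι' : E →+* ℂ` of an algebraically closed
field of characteristic zero which both intertwine a non-trivial involution `σ` with complex
conjugation agree on the fixed field `L` of `σ`: both are real on `L`, send squares of `L` to
non-negative reals, and `a - q` is `±` a square of `L` for every rational `q`
(`fixed_isSquare_or`), so `ι a` and `ι' a` have the same rational cuts.  (Equivalently: the real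
closed field `L` has a unique embedding into `ℝ`.)
[cite: Lang2002, XI §2 Thm. 2.2 (1st ed. XI §2 Thm. 1: a real closed field has a unique ordering,
positives = squares), with the uniqueness of order embeddings into ℝ] -/
theorem ringHom_apply_eq_of_fixed [IsAlgClosed E] [CharZero E] (σ : E ≃+* E)
    (hσ : ∀ y, σ (σ y) = y) {x : E} (hx : σ x ≠ x) (ι ι' : E →+* ℂ)
    (hι : ∀ z, ι (σ z) = starRingEnd ℂ (ι z)) (hι' : ∀ z, ι' (σ z) = starRingEnd ℂ (ι' z))
    {a : E} (ha : σ a = a) : ι a = ι' a := by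
  obtain ⟨i, hi⟩ := IsAlgClosed.exists_eq_mul_self (-1 : E)
  replace hi : i * i = -1 := hi.symm
  have hσi : σ i = -i := apply_sqrt_neg_one σ hσ hx hi
  -- squares of fixed elements go to non-negative reals
  have nonneg_of_sq : ∀ (κ : E →+* ℂ), (∀ z, κ (σ z) = starRingEnd ℂ (κ z)) →
      ∀ {b : E}, (∃ s, σ s = s ∧ b = s * s) → 0 ≤ (κ b).re := by
    rintro κ hκ b ⟨s, hs, rfl⟩
    rw [map_mul, ← re_eq_of_fixed σ κ hκ hs, ← Complex.ofReal_mul, Complex.ofReal_re]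
    exact mul_self_nonneg _
  -- a fixed element with positive image is a square of a fixed element
  have sq_of_pos : ∀ (κ : E →+* ℂ), (∀ z, κ (σ z) = starRingEnd ℂ (κ z)) →
      ∀ {b : E}, σ b = b → 0 < (κ b).re → ∃ s, σ s = s ∧ b = s * s := by
    intro κ hκ b hb hpos
    rcases fixed_isSquare_or σ hi hσi hb with h | ⟨s, hs, h⟩
    · exact h
    · exfalso
      have h0 : 0 ≤ (κ (-b)).re := nonneg_of_sq κ hκ ⟨s, hs, h⟩
      rw [map_neg, Complex.neg_re] at h0
      linarith
  -- comparison of rational cuts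
  have hle : ∀ (κ κ' : E →+* ℂ), (∀ z, κ (σ z) = starRingEnd ℂ (κ z)) →
      (∀ z, κ' (σ z) = starRingEnd ℂ (κ' z)) → (κ a).re ≤ (κ' a).re := by
    intro κ κ' hκ hκ'
    refine le_of_forall_rat_lt_imp_le fun q hq => ?_
    have haq : σ (a - q) = a - q := by rw [map_sub, ha, map_ratCast]
    have h1 : 0 < (κ (a - q)).re := by
      rw [map_sub, map_ratCast, Complex.sub_re, Complex.ratCast_re]; linarith
    have h2 := nonneg_of_sq κ' hκ' (sq_of_pos κ hκ haq h1)
    rw [map_sub, map_ratCast, Complex.sub_re, Complex.ratCast_re] at h2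
    linarith
  rw [← re_eq_of_fixed σ ι hι ha, ← re_eq_of_fixed σ ι' hι' ha,
    le_antisymm (hle ι ι' hι hι') (hle ι' ι hι' hι)]

/-- **Uniqueness of the embedding up to conjugation.** If `ι, ι' : E →+* ℂ` both intertwine the
non-trivial involution `σ` of the algebraically closed characteristic-zero field `E` with complex
conjugation, then `ι' = ι` or `ι' = conj ∘ ι` (they agree on the fixed field `L`, and
`E = L ⊕ iL` with `ι i, ι' i ∈ {± I}`).
[cite: Lang2002, XI §2 Thm. 2.2 (1st ed. XI §2 Thm. 1), uniqueness of the ordering of a real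
closed field; consequence for K̄ = L(i)] -/
theorem ringHom_eq_or_eq_conjugate [IsAlgClosed E] [CharZero E] (σ : E ≃+* E)
    (hσ : ∀ y, σ (σ y) = y) {x : E} (hx : σ x ≠ x) (ι ι' : E →+* ℂ)
    (hι : ∀ z, ι (σ z) = starRingEnd ℂ (ι z)) (hι' : ∀ z, ι' (σ z) = starRingEnd ℂ (ι' z)) :
    ι' = ι ∨ ι' = NumberField.ComplexEmbedding.conjugate ι := by
  obtain ⟨i, hi⟩ := IsAlgClosed.exists_eq_mul_self (-1 : E)
  replace hi : i * i = -1 := hi.symm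
  have hσi : σ i = -i := apply_sqrt_neg_one σ hσ hx hi
  have hfix : ∀ {a : E}, σ a = a → ι' a = ι a := fun ha =>
    (ringHom_apply_eq_of_fixed σ hσ hx ι ι' hι hι' ha).symm
  have hsq : ∀ (κ : E →+* ℂ), κ i = Complex.I ∨ κ i = -Complex.I := fun κ =>
    mul_self_eq_mul_self_iff.mp (by rw [← map_mul, hi, map_neg, map_one, Complex.I_mul_I])
  have hconj : starRingEnd ℂ (ι i) = -ι i := by
    rcases hsq ι with h | h
    · rw [h, Complex.conj_I]
    · rw [h, map_neg, Complex.conj_I, neg_neg]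
  have hreal : ∀ {a : E}, σ a = a → starRingEnd ℂ (ι a) = ι a := fun {a} ha => by
    rw [← hι a, ha]
  by_cases h : ι' i = ι i
  · left
    ext z
    obtain ⟨p, q, hp, hq, rfl⟩ := exists_fixed_add_mul σ hσ hi hσi z
    simp only [map_add, map_mul, hfix hp, hfix hq, h]
  · right
    have h' : ι' i = -ι i := by
      rcases hsq ι with h1 | h1 <;> rcases hsq ι' with h2 | h2
      · exact absurd (h2.trans h1.symm) h
      · rw [h2, h1]
      · rw [h2, h1, neg_neg]
      · exact absurd (h2.trans h1.symm) h
    ext z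
    obtain ⟨p, q, hp, hq, rfl⟩ := exists_fixed_add_mul σ hσ hi hσi z
    rw [NumberField.ComplexEmbedding.conjugate_coe_eq]
    simp only [map_add, map_mul, hfix hp, hfix hq, h', hconj, hreal hp, hreal hq, neg_mul]

end AbsGaloisInvolution

open _root_.NumberField AbsGaloisInvolution

section Uniqueness

variable {K : Type*} [Field K]

/-- **A complex conjugation determines its real embedding**: if `c ∈ Gal(K̄/K)` is a complex
conjugation for the real embeddings `φ` and `φ'` of `K`, then `φ = φ'`.  (The fixed field of `c` is
real closed with a unique embedding into `ℝ`.)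
[cite: Lang2002, XI §2 Thm. 2.2 (1st ed. XI §2 Thm. 1), uniqueness of the ordering of a real
closed field, applied to K̄^c] -/
theorem IsComplexConjugation.realEmbedding_unique {φ φ' : K →+* ℝ}
    {c : Field.absoluteGaloisGroup K} (hc : IsComplexConjugation φ c)
    (hc' : IsComplexConjugation φ' c) : φ = φ' := by
  haveI : CharZero K := charZero_of_realEmbedding φ
  obtain ⟨ι, hιφ, hι⟩ := isComplexConjugation_iff.mp hc
  obtain ⟨ι', hιφ', hι'⟩ := isComplexConjugation_iff.mp hc'
  set σA := Field.absoluteGaloisGroup.toAlgEquiv K c with hσA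
  let σ : AlgebraicClosure K ≃+* AlgebraicClosure K := σA
  have hσσ : ∀ y, σ y = c • y := fun y => rfl
  have hσ : ∀ y, σ (σ y) = y := fun y => by
    rw [hσσ, hσσ, ← mul_smul, ← pow_two, hc.sq_eq_one, one_smul]
  have hx : ∃ x, σ x ≠ x := by
    by_contra! h
    exact hc.ne_one (FaithfulSMul.eq_of_smul_eq_smul (α := AlgebraicClosure K)
      fun y => by rw [one_smul, ← hσσ]; exact h y)
  obtain ⟨x, hx⟩ := hx
  ext k
  have hk : σ (algebraMap K _ k) = algebraMap K _ k := σA.commutes k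
  have h := ringHom_apply_eq_of_fixed σ hσ hx ι ι' (fun z => hι z) (fun z => hι' z) hk
  have h1 := RingHom.congr_fun hιφ k
  have h2 := RingHom.congr_fun hιφ' k
  simp only [RingHom.comp_apply, Complex.ofRealHom_eq_coe] at h1 h2
  exact_mod_cast h1.symm.trans (h.trans h2)

/-- **A complex conjugation determines its real place**: if `c ∈ Gal(K̄/K)` is a complex
conjugation at the real places `w` and `w'` of `K`, then `w = w'`.
[cite: Lang2002, XI §2 Thm. 2.2 (1st ed. XI §2 Thm. 1), applied to K̄^c] -/
theorem IsComplexConjugationAt.place_unique {w w' : InfinitePlace K} {hw : w.IsReal}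
    {hw' : w'.IsReal} {c : Field.absoluteGaloisGroup K} (hc : IsComplexConjugationAt hw c)
    (hc' : IsComplexConjugationAt hw' c) : w = w' := by
  have h := IsComplexConjugation.realEmbedding_unique hc hc'
  rw [← InfinitePlace.mk_embedding w, ← InfinitePlace.mk_embedding w']
  congr 1
  ext1 k
  rw [← InfinitePlace.embedding_of_isReal_apply hw, ← InfinitePlace.embedding_of_isReal_apply hw',
    h]

end Uniqueness

section ClosurePlaces

variable {K : Type*} [Field K] [CharZero K]

/-- Over `K̄` itself: two embeddings `ι, ι' : K̄ →+* ℂ` under which the same non-trivial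
`c ∈ Gal(K̄/K)` acts as complex conjugation define the same infinite place of `K̄`
(`ι' = ι` or `ι' = conj ∘ ι`). [cite: Lang2002, XI §2 Thm. 2.2 (1st ed. XI §2 Thm. 1), applied
to K̄^c] -/
theorem infinitePlace_mk_eq_of_isConj {c : AlgebraicClosure K ≃ₐ[K] AlgebraicClosure K}
    (hc1 : c ≠ 1) (hc2 : c * c = 1) {ι ι' : AlgebraicClosure K →+* ℂ}
    (hι : ComplexEmbedding.IsConj ι c) (hι' : ComplexEmbedding.IsConj ι' c) :
    InfinitePlace.mk ι' = InfinitePlace.mk ι := by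
  let σ : AlgebraicClosure K ≃+* AlgebraicClosure K := c
  have hσσ : ∀ y, σ y = c y := fun y => rfl
  have hσ : ∀ y, σ (σ y) = y := fun y => by
    rw [hσσ, hσσ, ← AlgEquiv.mul_apply, hc2, AlgEquiv.one_apply]
  have hx : ∃ x, σ x ≠ x := by
    by_contra! h
    exact hc1 (AlgEquiv.ext fun y => h y)
  obtain ⟨x, hx⟩ := hx
  rcases ringHom_eq_or_eq_conjugate σ hσ hx ι ι' (fun z => hι.eq z) (fun z => hι'.eq z)
      with h | h
  · rw [h]
  · rw [h, InfinitePlace.mk_conjugate_eq]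

variable [Algebra.IsAlgebraic ℚ K]

/-- **The archimedean dictionary for `Gal(K̄/K)`** (`K` algebraic over `ℚ`): every involution
`τ ≠ 1` of `Gal(K̄/K)` fixes EXACTLY ONE infinite place of `K̄` (for the natural action of
`Gal(K̄/K)` on `NumberField.InfinitePlace K̄`), i.e. lies in the decomposition group `{1, τ}` of a
unique archimedean prime of `K̄`.  Existence is Artin–Schreier
(`exists_isComplexConjugation_of_sq_eq_one`); uniqueness is `infinitePlace_mk_eq_of_isConj`.
[cite: ArtinSchreier1927Kennzeichnung, Satz 4 (with the uniqueness of the ordering of the real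
closed field K̄^τ, Lang XI §2 Thm. 2.2)] -/
theorem existsUnique_infinitePlace_mem_stabilizer_of_sq_eq_one
    (τ : Field.absoluteGaloisGroup K) (h1 : τ ≠ 1) (h2 : τ ^ 2 = 1) :
    ∃! w : InfinitePlace (AlgebraicClosure K),
      Field.absoluteGaloisGroup.toAlgEquiv K τ ∈
        MulAction.stabilizer (AlgebraicClosure K ≃ₐ[K] AlgebraicClosure K) w := by
  set c := Field.absoluteGaloisGroup.toAlgEquiv K τ with hc
  have hc1 : c ≠ 1 := fun h => h1 ((MulEquiv.map_eq_one_iff _).mp h)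
  have hc2 : c * c = 1 := by rw [hc, ← map_mul, ← pow_two, h2, map_one]
  obtain ⟨φ, hφ⟩ := exists_isComplexConjugation_of_sq_eq_one τ h1 h2
  obtain ⟨ι, -, hι⟩ := hφ
  refine ⟨InfinitePlace.mk ι, (InfinitePlace.mem_stabilizer_mk_iff ι c).mpr (Or.inr hι), ?_⟩
  intro w hw
  rw [← InfinitePlace.mk_embedding w] at hw ⊢
  rcases (InfinitePlace.mem_stabilizer_mk_iff _ c).mp hw with h | h
  · exact absurd h hc1
  · exact infinitePlace_mk_eq_of_isConj hc1 hc2 hι h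

end ClosurePlaces

end Literature.NumberTheory.GaloisRepresentations
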